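import Mathlib

/-!
# The quadratic gauge-fixing form `G⁽²⁾` of Bałaban's averaged axial gauge DEPENDS on the background
# (cell pub-balaban, β sub-cell row an1, node GAUGE-TERM-BACKGROUND; [folklore] algebra, ZERO cited facts)

HONEST FRAMING (verbatim, cell charter): discharging `BetaPertH` makes Bałaban's UV stability UNCONDITIONAL —
a real constructive-QFT result; it is NOT the continuum limit and NOT the Clay problem.  This file is
finite-dimensional trace algebra over `Matrix n n R`; it proves NO statement of Bałaban's papers and mints NO
cited fact (ABSOLUTE RULE: no internally-minted statement enters as a cited fact; the papers appear below as
CONTEXT quotations only, read from page renders as images; the reading in §0 is DERIVED by the cell and its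
model inputs are HYPOTHESES, discharged nowhere here).  NOT summit progress.

CITATION HEADER (context only).  [Balaban1987RG1] T. Bałaban, *Comm. Math. Phys.* **109** (1987) 249–301
(cell paper B12): p. 253 the finite-set average axioms «M({U_j⁻¹}) = M({U_j})⁻¹; (0.5) M({uU_jv}) = uM({U_j})v;
(0.6)», «(1/i) log M({exp iA_j}) = (1/n) Σ_{j=1}^n A_j + (higher order terms); (0.8)», Federbush's definition
«Σ_{j=1}^n (1/i) log U_jU⁻¹ = 0. (0.10)», the averaged contour variable «U(y,x) = M({U(Γ)}_{Γ∈G(y,x)}). (0.11)»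
and «We need also a Euclidean invariant definition of the axial gauge fixing. A natural idea, in agreement with
the above definition, would be to use variables obtained by averaging the contour variables {U(Γ)}_{Γ∈G(y,x)},
rather than to use one contour variable U(Γ_{y,x})»; p. 255 (0.19) the gauge-fixing term of the k-th step
«−(1/g_k²) Σ_{y∈T^{(k+1)}} Σ_{x∈B(y),x≠y} [1 − Re tr U(y,x)]» and (p. 255, top) «By the gauge invariance with
respect to such transformations the integrand does not depend on u and the integral over u is equal to 1»;
p. 265 «choosing the element of the orbit satisfying the axial gauge conditions G(V) = 0» and «We introduce new
integration variables V′ = V(V^{(k)})⁻¹, or V = V′V^{(k)}»; p. 266 «The gauge fixing term under the exponential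
in (2.1) is equal to G(V′V^{(k)}) = G̃(V′) = G(B′). The variables Ṽ′(y,x) = (V′V^{(k)})(y,x)(V^{(k)}(y,x))⁻¹ have
an expansion of the form Ṽ′(y,x) = 1 + B̃′(y,x) + …, where B̃′(y,x) is a linear function, hence the gauge fixing
expression has the representation G(B′) = Σ_{y∈T^{(k+1)}} Σ_{x∈B(y),x≠y} ½|B̃′(y,x)|² + G₃(B′) = ½G⁽²⁾(B′) +
G₃(B′). (2.5)».

v1.0.1 (DOCSTRING-ONLY over v1 = p185160 f418bdff7568: equation number of the covariance axiom corrected to (0.6) at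
three places — (0.5) is the inversion axiom —, and the p. 265 basis of (c1)/(c2) for print's objects added in §4; every
declaration byte-identical).  §0 THE QUESTION AND THE READING (DERIVED; hypotheses explicit).  The cell's brick table for the one-loop
coefficient (HOME/BETA/AN2.md §15.4, ingredient (V-J)) carried the remark «G⁽²⁾ is U-independent»; print gives
G⁽²⁾ through B̃′(y,x), the linear part of the AVERAGED contour variable of V′V^{(k)} (DIVERGENCE D-an1.2).  Write
the background's contour holonomies as W_Γ = e^{iA_Γ}, Γ ∈ G(y,x), n = |G(y,x)|; the gauge condition G(V^{(k)}) = 0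
(a sum of the non-negative terms 1 − Re tr V^{(k)}(y,x)) says M({W_Γ}) = 1 for every (y,x), which for Federbush's
average (0.10) is Σ_Γ A_Γ = 0 — it does NOT say W_Γ = 1 unless n = 1.  (H-BCH) [first-order
Baker–Campbell–Hausdorff, standard; NOT formalised here, checked numerically by the cell to 1e-11]:
d/dt log(e^{tP}e^{Q})|₀ = ψ_L(ad_Q)P and d/dt log(e^{Q}e^{tP})|₀ = ψ_R(ad_Q)P with ψ_L(z) = z/(e^z − 1) = 1 − z/2 + …,
ψ_R(z) = z/(1 − e^{−z}) = 1 + z/2 + ….  Linearising (0.10) at {W_Γ} along U_Γ(t) = e^{itX_Γ}W_Γ, U(t) = e^{itu+…}: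
u = (Σ_Γ ψ_R(ad_{iA_Γ}))⁻¹ Σ_Γ ψ_L(ad_{iA_Γ}) X_Γ = (1/n) Σ_Γ (X_Γ − ½[iA_Γ, X_Γ]) + O(A²X)   (using Σ_Γ A_Γ = 0),
and X_Γ = Σ_{b∈Γ} Ad(W_{Γ<b}) B′(b) = Σ_{b∈Γ} (B′(b) + [iA_{Γ<b}, B′(b)]) + O(A²B′) (product rule along Γ).  Hence
  B̃′(y,x) = ℓ_{yx}(B′) + c_{yx}(B′, A) + O(A²B′),   ℓ_{yx}(B′) = (1/n) Σ_Γ Σ_{b∈Γ} B′(b),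
  c_{yx}(B′, A) = (1/n) Σ_Γ ( Σ_{b∈Γ} [iA_{Γ<b}, B′(b)] − ½ [iA_Γ, Σ_{b∈Γ} B′(b)] )      — a COMMUTATOR-type term,
so |B̃′(y,x)|² = |ℓ(B′)|² + 2⟨ℓ(B′), c(B′,A)⟩ + O(A²): the quadratic gauge-fixing form has a FIRST-ORDER background
vertex unless the cross term vanishes identically.  §1 computes the cross term in closed form on the smallest
averaged block (d = 2, the 2×2 block: contours Γ₁ = (e₁,e₃), Γ₂ = (e₂,e₄) from the centre y to the far corner, gauge
condition a = b = 0 on e₁,e₂ and A(e₄) = −A(e₃) =: −C, so W_{Γ₁} = e^{iC}, W_{Γ₂} = e^{−iC}, a background with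
plaquette e^{2iC} ≠ 1): with P = B′(e₁) + B′(e₃), Q = B′(e₂) + B′(e₄), K = iC,
  u₁ = ½(P + Q) − ¼[K, P − Q],   tr(u₁²) = tr(ℓ²) − ½ tr(K[P,Q]) + tr(c²)          (`toy_trace_sq`),
i.e. ∂_C of the B′-quadratic part (1/2N)Tr(u₁²) of 1 − Re tr Ṽ′(y,x) equals −(1/4N)Tr(iC[P,Q]) — generically
NON-ZERO (`crossTerm_witness`: the trilinear form tr(K[P,Q]) is not identically zero), and confirmed by the cell's
second engine on the full nonlinear definitions (Federbush average solved to 1e-17, ratio numeric/predicted =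
1.0000 ± 2e-5 over three random su(2) draws; `HOME/b2b-balaban-beta-an1-g9/g2/toyblock_check.py` + `.log`).  §2: the vertex has
ZERO TADPOLE — for a colour-blind Gaussian B′ the expectation of tr(B′(b₁)[K, B′(b₂)]) is Γ(b₁,b₂)·Σ_a tr(E_a[K,E_a])
= 0 term by term (`trace_mul_comm_self`, `tadpole_sum_eq_zero`) — consistent with `Beta.MultiplierSector`'s colour
lemma (commutator blocks are colour-traceless); it enters the one-loop coefficient only through MIXED BUBBLES
¼tr(ΓK₁ΓK₁) with the other first-order vertices, and through the tadpole of its SECOND-order part.  §3: in the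
single-contour complete axial gauge (n = 1, tree-consistent contours, the gauge of B12's refs. [9,16]) the
conditions W_{Γ_{y,x′}} = 1 for all x′ ∈ B(y) kill the background on every tree bond, so G(V′V^{(k)}) = G(V′)
EXACTLY — there G⁽²⁾ is background-FREE to all orders (this is the regime of the cell's typed axial SLICE, AN2
D-an2.4, where «U-independent» is correct).  §4 (WHY IT NEVERTHELESS DROPS OUT AT ONE LOOP — conditional, by the tree
module `Beta.GaugeFixing`): by the covariance axiom (0.6) alone, a residual gauge transformation (u(y) = 1 at block
centres) acts on every gauge-fixing variable by RIGHT multiplication with a background conjugate of u(x)⁻¹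
(`row_transform`, `gaugeVariable_transform`), whatever the background and the average; linearised, τ(B)·W(B) (slice rows
× exact linearised residual gauge directions W(B)λ = (λ(b₋) − Ad V^{(k)}(b) λ(b₊))_b, a square system) is minus a
blockwise Ad-isometry, so log|det τ(B)W(B)| = 0 for EVERY background [checked to first order on the toy block: for
B′ = W(B)λ one gets P + Q = −2λ(x) exactly at first order and P − Q = O(C), so u₁ = −λ(x) + O(C²)]; likewise the
single-contour slice P₀ (evaluation on tree bonds) has |det P₀W(B)| = 1 for every background (block-triangular along the
tree with diagonal blocks −Ad V^{(k)}(b)).  Hence, GRANTED `Beta.GaugeFixing`'s dictionary clauses (c1) Δ(B)W(B) = 0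
(two-sided) and (c2) Q(B)W(B) = 0 with admissibility for the cell's concrete UNFIXED fluctuation form Δ(B) (Wilson Hessian
+ multiplier term ⟨J, C⁽²⁾⟩, cf. `Beta.MultiplierSector`) and averaging constraints — clauses owned by the rows building
those operators (OBJECTS.md §5(h), D-pv25.4), NOT verified here; for PRINT's objects they are the cell's DERIVED
reading of p. 265 («The gauge covariance of the averages implies that the δ-functions in (2.1) are invariant under the
gauge transformations V → V^v, W → W^v», «A gauge transformation v of V induces the gauge transformation v of V^{(k)} and
the transformation B′ → R(v)B′. The expressions in (2.1) are invariant with respect to these transformations», and V^{(k)}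
= «the element of the orbit satisfying the axial gauge conditions G(V) = 0» of «the critical orbit of the function
A(U_k(V)) considered on the subspace»): the Lagrangian A(U_k(V′V^{(k)})) + ⟨multiplier, constraint⟩ is invariant under
the residual group and critical at V′ = 1 in all directions, so its Hessian — the UNFIXED form, multiplier term
⟨J, C⁽²⁾⟩ included, which is exactly where `Beta.MultiplierSector`'s sector is needed — annihilates the orbit tangents
W(B)λ (c1), and the linearised constraint does too (c2) — `GaugeFixing.logZ_add_weight_one` +
`GaugeFixing.logZ_slice_change` give logZ(Δ(B) + τ(B)ᵀτ(B), Q(B)) = logZ(Δ(B), [Q(B); P₀]) + const: the one-loop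
normalisation, hence the polarization and β⁰_T, do not see τ(B) at all.  UPSHOT (the cell's, not Bałaban's): in B12's
printed Euclidean-invariant AVERAGED gauge (n ≥ 2) the form G⁽²⁾(B′) DOES depend on the background V^{(k)} from FIRST
order on (a commutator-type vertex with zero tadpole) — «G⁽²⁾ is U-independent» is false as a statement about G⁽²⁾ —
but its background dependence is PURE FADDEEV–POPOV: conditional on (c1)/(c2) it cancels exactly out of the one-loop
coefficient, which may therefore be book-kept in the background-free single-contour slice P₀ (the regime of AN2's
typed axial slice, D-an2.4); an ingredient-by-ingredient (T-def) table in the averaged exponential gauge must EITHER carry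
(G⁽²⁾)₁ (mixed bubbles) and (G⁽²⁾)₂ (tadpole) together with the matching −log|det τ(B)W(B)| ≡ 0 bookkeeping, OR invoke
this slice change once and drop them.  NOT HERE: (H-BCH) itself, any bound,
the value of any bubble, the sign or size of the resulting contribution to β⁰, `BetaPertH`.  No `sorry`; axioms
`propext`, `Classical.choice`, `Quot.sound`.
-/

namespace Literature.MathematicalPhysics.QuantumFieldTheory.Balaban1983to89.Beta.GaugeTermBackground

open Matrix

section TraceAlgebra

variable {n : Type*} [Fintype n] {R : Type*} [CommRing R]

/-- The ring commutator of two square matrices, `⁅X, Y⁆ = XY − YX`, as a plain definition (we do not use the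
`Bracket` instance to keep rewriting explicit). [folklore] -/
def comm (X Y : Matrix n n R) : Matrix n n R := X * Y - Y * X

/-- Unfolding lemma for `comm`. [folklore] -/
@[simp] theorem comm_def (X Y : Matrix n n R) : comm X Y = X * Y - Y * X := rfl

/-- Cyclicity in the form used throughout: `tr(X · C · Y) = tr(C · Y · X)`. [folklore] -/
theorem trace_three_cycle (X C Y : Matrix n n R) :
    trace (X * C * Y) = trace (C * Y * X) :=
  (Matrix.trace_mul_cycle C Y X).symm

/-- SINGLE-BOND VANISHING: `tr(X [K, X]) = 0` — a commutator-type vertex paired with the SAME fluctuation on both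
legs has no diagonal part (this is why a fluctuation supported on one bond sees no first-order background in
`|B̃′|²`). [folklore] -/
theorem trace_mul_comm_self (X K : Matrix n n R) : trace (X * comm K X) = 0 := by
  simp only [comm_def, Matrix.mul_sub, Matrix.trace_sub, ← Matrix.mul_assoc]
  rw [Matrix.trace_mul_cycle X K X, sub_self]

/-- THE CROSS-TERM IDENTITY: `tr((P + Q) [K, P − Q]) = 2 tr(K [P, Q])` — the first-order background dependence of
`|ℓ + c|²` on the 2×2 block reduces to the single trilinear invariant `tr(K[P,Q])` (structure-constant type).
[folklore] -/
theorem crossTerm_identity (P Q K : Matrix n n R) :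
    trace ((P + Q) * comm K (P - Q)) = 2 * trace (K * comm P Q) := by
  simp only [comm_def, Matrix.mul_sub, Matrix.sub_mul, Matrix.add_mul, Matrix.trace_sub, Matrix.trace_add,
    ← Matrix.mul_assoc]
  have h1 : trace (P * K * P) = trace (K * P * P) := (Matrix.trace_mul_cycle K P P).symm
  have h2 : trace (Q * K * Q) = trace (K * Q * Q) := (Matrix.trace_mul_cycle K Q Q).symm
  have h3 : trace (P * K * Q) = trace (K * Q * P) := (Matrix.trace_mul_cycle K Q P).symm
  have h4 : trace (Q * K * P) = trace (K * P * Q) := (Matrix.trace_mul_cycle K P Q).symm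
  have h5 : trace (P * P * K) = trace (K * P * P) := Matrix.trace_mul_cycle P P K
  have h6 : trace (Q * Q * K) = trace (K * Q * Q) := Matrix.trace_mul_cycle Q Q K
  have h7 : trace (P * Q * K) = trace (K * P * Q) := Matrix.trace_mul_cycle P Q K
  have h8 : trace (Q * P * K) = trace (K * Q * P) := Matrix.trace_mul_cycle Q P K
  rw [h1, h2, h3, h4, h5, h6, h7, h8]
  ring

/-- ZERO TADPOLE: for ANY finite family `E` (an orthonormal colour basis in the application) and any `K`,
`Σ_a tr(E_a [K, E_a]) = 0` — so a colour-blind Gaussian expectation of the first-order gauge-term vertex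
`tr(B′(b₁)[K, B′(b₂)]) = Γ(b₁,b₂) Σ_a tr(E_a[K,E_a])` vanishes. [folklore] -/
theorem tadpole_sum_eq_zero {ι : Type*} (s : Finset ι) (E : ι → Matrix n n R) (K : Matrix n n R) :
    ∑ a ∈ s, trace (E a * comm K (E a)) = 0 :=
  Finset.sum_eq_zero (fun a _ => trace_mul_comm_self (E a) K)

/-- The colour-blind Gaussian form of the previous statement: with covariance `E[B′_a(b₁) B′_c(b₂)] = δ_ac γ`
(γ = Γ(b₁,b₂) a scalar) the expectation `Σ_{a,c} δ_ac γ tr(E_a [K, E_c])` of the vertex is zero. [folklore] -/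
theorem tadpole_colourBlind_eq_zero {ι : Type*} [Fintype ι] [DecidableEq ι] (E : ι → Matrix n n R)
    (K : Matrix n n R) (γ : R) :
    ∑ a, ∑ c, (if a = c then γ else 0) * trace (E a * comm K (E c)) = 0 := by
  have h : ∀ a, ∑ c, (if a = c then γ else 0) * trace (E a * comm K (E c)) = γ * trace (E a * comm K (E a)) := by
    intro a
    rw [Finset.sum_eq_single a]
    · simp
    · intro c _ hca
      simp [Ne.symm hca]
    · simp
  simp_rw [h, trace_mul_comm_self, mul_zero, Finset.sum_const_zero]

end TraceAlgebra

section ToyBlock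

variable {n : Type*} [Fintype n] {R : Type*} [Field R]

/-- The U = 1 linear map of the 2×2 block's far corner: `ℓ = ½(P + Q)` (average over the two contours of the
summed bond fluctuations `P = B′(e₁)+B′(e₃)`, `Q = B′(e₂)+B′(e₄)`). [folklore] -/
def toyL (P Q : Matrix n n R) : Matrix n n R := (1/2 : R) • (P + Q)

/-- The FIRST-ORDER background term of the linearised Federbush average on the 2×2 block (DERIVED in §0 under
(H-BCH); `K` stands for `iC`, `C` the background on `e₃`, `−C` on `e₄`): `c = −¼ [K, P − Q]`. [folklore] -/
def toyC (K P Q : Matrix n n R) : Matrix n n R := (-(1/4 : R)) • comm K (P - Q)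

/-- The linearised gauge variable of the far corner to first order in the background: `u₁ = ℓ + c`. [folklore] -/
def toyU (K P Q : Matrix n n R) : Matrix n n R := toyL P Q + toyC K P Q

/-- At zero background the toy variable is the plain two-contour average (B12 (0.8)). [folklore] -/
theorem toyU_zero (P Q : Matrix n n R) : toyU 0 P Q = toyL P Q := by
  simp [toyU, toyC, comm]

/-- THE TOY CROSS TERM: `tr(u₁²) = tr(ℓ²) − ½ tr(K[P,Q]) + tr(c²)`; the middle term is the part LINEAR in the
background (`c²` is second order).  With the normalisation `1 − Re tr e^{iu} = (1/2N)Tr(u²) + O(u⁴)` this is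
`∂_C [(1/2N)Tr(u₁²)] = −(1/4N)Tr(iC[P,Q])`, the coefficient confirmed numerically on the nonlinear definitions.
[folklore] -/
theorem toy_trace_sq [CharZero R] (K P Q : Matrix n n R) :
    trace (toyU K P Q * toyU K P Q) =
      trace (toyL P Q * toyL P Q) - (1/2 : R) * trace (K * comm P Q) + trace (toyC K P Q * toyC K P Q) := by
  have hcross : trace (toyL P Q * toyC K P Q) = -(1/4 : R) * trace (K * comm P Q) := by
    simp only [toyL, toyC, Matrix.smul_mul, Matrix.mul_smul, Matrix.trace_smul, smul_eq_mul]
    rw [crossTerm_identity]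
    ring
  have hcross' : trace (toyC K P Q * toyL P Q) = -(1/4 : R) * trace (K * comm P Q) := by
    rw [Matrix.trace_mul_comm, hcross]
  simp only [toyU, Matrix.add_mul, Matrix.mul_add, Matrix.trace_add]
  rw [hcross, hcross']
  ring

/-- Consequently the background-LINEAR part of `tr(u₁²)` is exactly `−½ tr(K[P,Q])`: subtracting the zeroth-order
and the manifestly second-order pieces leaves the cross term. [folklore] -/
theorem toy_linear_part [CharZero R] (K P Q : Matrix n n R) :
    trace (toyU K P Q * toyU K P Q) - trace (toyL P Q * toyL P Q) - trace (toyC K P Q * toyC K P Q) =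
      -(1/2 : R) * trace (K * comm P Q) := by
  rw [toy_trace_sq]; ring

end ToyBlock

section Covariance

/-- A finite-set average on a group together with Bałaban's two-sided covariance axiom ([Balaban1987RG1] (0.6) p. 253
«M({uU_jv}) = uM({U_j})v») as a HYPOTHESIS field.  (Federbush's (0.10) satisfies it: `Σ_j log(uU_jv·(uUv)⁻¹) =
u(Σ_j log U_jU⁻¹)u⁻¹`.)  A posited structure; nothing of the papers is asserted. [folklore] -/
structure CovariantAverage (G : Type*) [Group G] (ι : Type*) where
  /-- the average of a family of group elements -/
  M : (ι → G) → G
  /-- two-sided covariance, (0.6) -/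
  cov : ∀ (u v : G) (U : ι → G), M (fun j => u * U j * v) = u * M U * v

variable {G : Type*} [Group G] {ι : Type*}

/-- RESIDUAL GAUGE RESPONSE OF A GAUGE-FIXING ROW (group level): all contours of `G(y,x)` run from the block centre `y`
(where the residual transformation is `1`, p. 254 «u(y) = 1 for y ∈ T^{(1)}») to `x` (where it is `ux`), so every contour
holonomy goes `V(Γ) ↦ V(Γ)·ux⁻¹` and the averaged variable `V(y,x) ↦ V(y,x)·ux⁻¹` — WHATEVER the background and the
average. [folklore] -/
theorem row_transform (A : CovariantAverage G ι) (V : ι → G) (ux : G) :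
    A.M (fun Γ => V Γ * ux⁻¹) = A.M V * ux⁻¹ := by
  simpa using A.cov 1 ux⁻¹ V

/-- Hence the gauge-fixing VARIABLE `Ṽ′(y,x) = (V′V^{(k)})(y,x)·(V^{(k)}(y,x))⁻¹` of (2.5) responds to a residual gauge
transformation by RIGHT multiplication with the background conjugate `V^{(k)}(y,x)·ux⁻¹·V^{(k)}(y,x)⁻¹`, an element NOT
involving the fluctuation `V′`.  Linearised this reads `τ(B)·W(B) = −(blockwise Ad-isometry)` (rows `(y,x)` ↔ residual
parameters `λ(x)`, a square system), so `log|det τ(B)W(B)| = 0` for EVERY background: the τ-half of the Faddeev–Popov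
quotient (c3) of the tree module `Beta.GaugeFixing` is trivially constant although `τ(B)` itself is background-DEPENDENT
(§1–§2).  [folklore] -/
theorem gaugeVariable_transform (A : CovariantAverage G ι) (V : ι → G) (Vk ux : G) :
    A.M (fun Γ => V Γ * ux⁻¹) * Vk⁻¹ = (A.M V * Vk⁻¹) * (Vk * ux⁻¹ * Vk⁻¹) := by
  rw [row_transform]; group

end Covariance

section Witness

/-- NON-VANISHING WITNESS: the trilinear invariant `tr(K[P,Q])` is not identically zero — already for the real
3×3 antisymmetric generators of so(3) ≅ su(2) (adjoint representation; `[L₁,L₂] = L₃`, `tr(L₃²) = −2`).  Hence the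
first-order background vertex of `G⁽²⁾` on the averaged 2×2 block is NOT identically zero. [folklore] -/
theorem crossTerm_witness :
    ∃ K P Q : Matrix (Fin 3) (Fin 3) ℚ, Matrix.trace (K * comm P Q) ≠ 0 := by
  refine ⟨!![0, -1, 0; 1, 0, 0; 0, 0, 0], !![0, 0, 0; 0, 0, -1; 0, 1, 0], !![0, 0, 1; 0, 0, 0; -1, 0, 0], ?_⟩
  simp [comm, Matrix.trace, Fin.sum_univ_three]

/-- … while on a SINGLE bond (P proportional to Q, e.g. `Q = 0`) it vanishes identically, matching §0's remark that
one-bond fluctuations see no first-order background. [folklore] -/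
theorem crossTerm_single_bond {n : Type*} [Fintype n] {R : Type*} [CommRing R]
    (K P : Matrix n n R) : Matrix.trace (K * comm P P) = 0 := by
  simp [comm]

end Witness

end Literature.MathematicalPhysics.QuantumFieldTheory.Balaban1983to89.Beta.GaugeTermBackground
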